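import Summits.BirchSwinnertonDyer.BirchSwinnertonDyer.Theorems.KolyvaginDepthDoorDepthTableRowKitTwoPrint
import Summits.BirchSwinnertonDyer.BirchSwinnertonDyer.Theorems.KolyvaginDepthDoorDepthTableRowRankThree5077a1NoTwist
import HarnessLib

/-!
# Route `KolyvaginDepthDoor` — rank-3 DEPTH-TWO depth-table rows `5077a1` ON (γ) ONLY
# (Kodaira–Néron certified in the kernel; crux `KolyvaginDepthSupply`, stmt-BirchSwinnertonDyer-21765)
# — part 1 of 5

Helper file (`--supports stmt-BirchSwinnertonDyer-21765 --as helper`); it closes nothing and BSD is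
not proved by it.

g6/g7's rank-3 rows display the FIVE named McCallum / Gross leaves; `…RowsRankThreePrint*` (this seat)
read them modulo (γ) + F1. This file drops F1 as well: every curve here is on the Kodaira–Néron cell at
`5` (`5 ∤ ord_v Δ_min` at multiplicative `v`, certified from `Δ(E₀)` by the `decide`-able table of
`depthRowTwo_print_kodairaNeron_of_datum_of_intModel_certificate`; no additive clause at `p = 5`), so
McCallum's Lemma 4.3 is a theorem for them (`…LeafLocalPow`). Inputs of each row: (γ) =
`GrossLMS1991.prop37_2_frobeniusCongruence` + the depth-2 bit at ANY datum of conductor `ℓ₁ℓ₂`; every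
other side condition is a kernel theorem. Conclusions as g7's minus the twist-Selmer count
(`#Sel_5(E^{(D)}) ≤ 25`, which stays available modulo (γ) + F1 in `…RowsRankThreePrint*`).
CONDITIONAL on (γ) and the bit; per-curve; BSD is not proved by it.
-/

set_option linter.dupNamespace false

noncomputable section

open scoped Classical

namespace Summit.BirchSwinnertonDyer.BirchSwinnertonDyer.Theorems.KolyvaginDepthDoor

open Literature.NumberTheory.EllipticCurves Literature.NumberTheory.EllipticCurves.ModularForms
  Literature.NumberTheory.EllipticCurves.McCallum1991 WeierstrassCurve
open Summit.BirchSwinnertonDyer.BirchSwinnertonDyer.Theorems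
open Summit.BirchSwinnertonDyer.BirchSwinnertonDyer.Rank2Observatory
open Summit.BirchSwinnertonDyer.BirchSwinnertonDyer.Rank1Residual
open Summit.BirchSwinnertonDyer.Rank1Residual.Additive

namespace C5077a1

/-- **DEPTH-TWO ROW `5077a1`, `(p, d_K, ℓ₁ℓ₂) = (5, −7, 229·349)`, twist-free, without Kolyvagin's
structure theorem, NO SYSTEM (bit at ANY datum).** For `E = 5077a1` (rank `3`), ANY imaginary
quadratic `K` with `d_K = −7`, any frame `(Dt, β, ι)` and ANY single Kolyvagin–Heegner datum `d` of
conductor `229·349` (no system, no coherence binders), granted the ONE Literature fact (γ) = Gross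
1991 Prop. 3.7 (2) (KN certified from `Δ(E₀) = 5077`) (Gross Prop. 5.4 (2); McCallum Lemma 4.3,
Prop. 4.4, Lemma 5.3, Prop. 2.2): IF the depth-2 derived class on the two Kolyvagin primes `229,
349` does not vanish, `d.kolyvaginClass _ 1 ≠ 0` (`d` of conductor `229·349`), THEN `corank_{ℤ_5}
Ш(E)[5^∞] = 0`, `rank_ℤ E(ℚ) = 3`, `rank_ℤ E^{(−7)}(ℚ) ≤ 2`, `E(ℚ)[5] = 0`, `Ш(E/ℚ)[5] = 0`,
`#Sel^(5)(E/ℚ) = 5³` and . Every side condition (`5 ∈ B(E)`, non-CM, Heegner hypothesis, both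
Kolyvagin primes, `3 ≤ rank`) is a kernel theorem. CONDITIONAL on (γ) and the bit; per-curve; BSD is
not proved by it. [cite: Kolyvagin1991MathAnn, Thm. 2.3] [cite: McCallumLMS1991, §§2–5] [cite:
GrossLMS1991, §5 (5.1)] [cite: CremonaAlgorithms1997, Table 1 (5077a1)] -/
theorem depthRow_5_neg7_229_349_printKN
    (h372 : GrossLMS1991.prop37_2_frobeniusCongruence)
    (K : Type) [Field K] [NumberField K] (hK : IsImaginaryQuadratic K)
    (hD : NumberField.discr K = -7) :
    haveI := isElliptic_of_mem_atlasR3A00 mem_atlas;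
    haveI := isGloballyMinimal_of_mem_atlasR3A00 mem_atlas;
    haveI : NeZero ((c5077a1.e.baseChange ℚ).conductorNorm ℤ) := neZero_conductorNorm_of_isElliptic _;
    ∀ (Dt : ModularParametrizationData (c5077a1.e.baseChange ℚ) ((c5077a1.e.baseChange ℚ).conductorNorm ℤ))
      (β : ℤ) (ι : K →+* ℂ) (d : KolyvaginHeegnerData Dt β ι (229 * 349)),
    d.kolyvaginClass (p := 5) (by norm_num) 1 ≠ 0 →
    (c5077a1.e.baseChange ℚ).shaCorank 5 = 0 ∧ (c5077a1.e.baseChange ℚ).mordellWeilRank = 3 ∧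
      ((c5077a1.e.baseChange ℚ).quadraticTwist ((-7 : ℤ) : ℚ)).mordellWeilRank ≤ 2 ∧
      (∀ P : (c5077a1.e.baseChange ℚ).toAffine.Point, 5 • P = 0 → P = 0) ∧
      (∀ x ∈ (c5077a1.e.baseChange ℚ).sha, 5 • x = 0 → x = 0) ∧
      Nat.card ↥(selmerGroup (c5077a1.e.baseChange ℚ) ((5 : ℕ) : ℤ)) = 5 ^ 3 := by
  haveI := isElliptic_of_mem_atlasR3A00 mem_atlas
  haveI := isGloballyMinimal_of_mem_atlasR3A00 mem_atlas
  haveI : NeZero ((c5077a1.e.baseChange ℚ).conductorNorm ℤ) := neZero_conductorNorm_of_isElliptic _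
  intro Dt β ι d hne
  haveI := Fact.mk (by norm_num : Nat.Prime 5)
  exact depthRowTwo_print_kodairaNeron_of_datum_of_intModel_certificate intModel h372 not_hasCM
    three_le_rank 5 (by norm_num) hasSurjectiveModNGaloisRep_pow_5 K hK hD (by norm_num) (by norm_num)
    heegner_neg7
    229 (by norm_num) (by norm_num) (by decide +kernel) (by norm_num) (by norm_num) (by norm_num)
    (by norm_num) (n₁ := 240) card_229 (by norm_num)
    349 (by norm_num) (by norm_num) (by decide +kernel) (by norm_num) (by norm_num) (by norm_num)
    (by norm_num) (n₂ := 385) card_349 (by norm_num) (by norm_num)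
    (Δ₀ := 5077) (by decide +kernel) (B := 11) (by decide +kernel) (by decide +kernel)
    (fun _ _ ↦ Or.inl (by norm_num)) Dt β ι d hne

end C5077a1

end Summit.BirchSwinnertonDyer.BirchSwinnertonDyer.Theorems.KolyvaginDepthDoor

end
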